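import Literature.MathematicalPhysics.QuantumFieldTheory.ConformalBootstrap3D.PointKernelK34v2Data
import Literature.MathematicalPhysics.QuantumFieldTheory.ConformalBootstrap3D.PointKernelParts

/-!
# K34v2 certificate, kernel part file P19: one-cell head segments 140, 141 in level ranges

The head cells whose kernel evaluation exceeds one `decide` are one-cell segments of `hsegsK34v2`; each is
checked by `PCert.hPartSideOK` (side conditions) and `PCert.hPartOK` per level range `[n_lo, n_lo + count)`
against an integer claim, the claims summing to `≥ 0` (`PointKernel.partsOK`); soundness is
`PCert.hParts_sound` (`PointKernelParts`).  The part files `P1, P2, …` are mutually independent (each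
imports only the data file); the ranges of one cell may span several of them, and the per-cell
conclusions `hparts_i` / `hcell_i` of those cells are assembled in `PointKernelK34v2.lean`.
Estimated kernel time 242 s.
-/

set_option maxRecDepth 100000
set_option maxHeartbeats 0

namespace Literature.MathematicalPhysics.QuantumFieldTheory.ConformalBootstrap3D.PointKernelK34v2

open Literature.MathematicalPhysics.QuantumFieldTheory.ConformalBootstrap3D.PointKernel

/-- levels `[68, 71)` of segment 140: partial lower sum `≥` claim. [folklore] -/
theorem part_140_8 : certK34v2.hPartOK (PCert.segAt hsegsK34v2 140) JHK34v2 68 3 (124840148866074663729363029252520253) = true := by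
  decide +kernel

/-- levels `[71, 73)` of segment 140: partial lower sum `≥` claim. [folklore] -/
theorem part_140_9 : certK34v2.hPartOK (PCert.segAt hsegsK34v2 140) JHK34v2 71 2 (56696539083085349827811723995061207) = true := by
  decide +kernel

/-- one-cell segment 141 (row 6, cell `[14337/2048, 28675/4096]`, chord, `n_F = 72`,
10 level ranges): side conditions. [folklore] -/
theorem pside_141 : certK34v2.hPartSideOK (PCert.segAt hsegsK34v2 141) JHK34v2 = true := by
  decide +kernel

/-- its level ranges `(n_lo, count, claim)`. [folklore] -/
def parts_141 : List (ℕ × ℕ × ℤ) := [(0, 25, -43216391628809134684809502856119589737), (25, 11, 27496540584760698918681204848777652539), (36, 8, 9203347369893894691895599984675998627), (44, 6, 3321318638142892847917568712734425150), (50, 5, 1508912912105747739402694309802713215), (55, 5, 860988531861636123708907868980355077), (60, 4, 405458193756604542094379662026097186), (64, 4, 252256365212639993468884789631261039), (68, 3, 117861863727716807956845443579674360), (71, 2, 49707169347303019683417235911412551)]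

/-- the ranges tile `[0, n_F]` and the claims sum to `≥ 0`. [folklore] -/
theorem pcov_141 : PointKernel.partsOK 72 parts_141 = true := by
  decide +kernel

/-- levels `[0, 25)` of segment 141: partial lower sum `≥` claim. [folklore] -/
theorem part_141_0 : certK34v2.hPartOK (PCert.segAt hsegsK34v2 141) JHK34v2 0 25 (-43216391628809134684809502856119589737) = true := by
  decide +kernel

/-- levels `[25, 36)` of segment 141: partial lower sum `≥` claim. [folklore] -/
theorem part_141_1 : certK34v2.hPartOK (PCert.segAt hsegsK34v2 141) JHK34v2 25 11 (27496540584760698918681204848777652539) = true := by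
  decide +kernel

end Literature.MathematicalPhysics.QuantumFieldTheory.ConformalBootstrap3D.PointKernelK34v2
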